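import Summits.HodgeConjecture.CorCM.MultiFieldWeilDihedralDecicsGrouped
import Summits.HodgeConjecture.CorCM.MultiFieldWeilDihedralMeet
import HarnessLib

/-!
# MULTI-FIELD WEIL ENGINE — DIHEDRAL DECIC FIELDS GROUPED BY FIELD, FREENESS BY INSPECTION: over each dihedral decic field with two structures, the two types DIFFER on and
# SHARE a `τ`-embedding — the Hodge conjecture for every product of copies, given only Markman's hyperbolic-sixfold theorem

Cell `pub-hodgecm2` (COR-CM), seat b30 gen 42 (2026-08-26); count-neutral own lane MULTI-FIELD WEIL ENGINE (stem `MultiFieldWeil*`), the sequel of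
`CorCM/MultiFieldWeilDihedralDecicsGrouped.lean` (`hodgeConjectureFor_biproduct_sigma_of_dihedralDecics'`, freeness on automorphisms of `ℂ` asked of the fields with two structures)
and `CorCM/MultiFieldWeilDihedralMeet.lean`.  Theorems only; no definition, no named fact, no `sorry`.  HONEST FRAMING: conditional ONLY on the displayed Markman binder `hM6`; `HC_CM`
is NOT proved and not asserted.

* `comp_eq_of_stab_of_meet_family` (field level, any index type of types): over a decic CM field `K ⊇ iK(k)` with Galois closure of degree `≤ 20` in `ℂ` and a `τ`-embedding value
  outside the image of another, if two of the types have DIFFERENT `τ`-parts SHARING an embedding, every automorphism of `ℂ` over `τ(k)` stabilising all `τ`-parts fixes every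
  `τ`-embedding of `K` (one-slot engine instance + `eq_one_of_stab_meeting_realisedTuples`; the `Fin 2` case is `comp_eq_of_stab_of_meet` of `…DihedralDecicShowcaseMeet`).
* **`hodgeConjectureFor_biproduct_sigma_of_dihedralDecics_meet`**: `k` imaginary quadratic, `E ⊨ (k;{τ})`; decic CM fields `K_j ∋ k` with `[L(K_j):ℚ] ≤ 20` and an outside value
  (DIHEDRAL quintic parts); over each `K_j` at most two structures `B_{j,t} ⊨ (K_j; Ψ_{j,t})` with two `τ`-members, and WHEN TWO, their `τ`-parts DIFFERENT and SHARING an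
  embedding; `Hom(K_{j'}, K_j) = ∅` for `j' ≠ j` ⟹ the Hodge conjecture for every product of copies of `E` and the `B_{j,t}`, and (dominated form) everything dominated by one —
  GIVEN ONLY Markman's hyperbolic-sixfold theorem.  Every hypothesis is read off the fields and the types.
[cite: Markman2025SecantWeil, Thm 1.5.1] [cite: Shimura1998, §6.1 Corollary of Theorem 2, §8.4, §18.2 Lemma (i)] [cite: DixonMortimer1996, §1.6, Thm. 1.6A; §2.1; §3.3]
[cite: Serre1977, §5.3] [cite: Lang2002, VI §1 Thm. 1.1 and V §2 Thm. 2.8; XIII §4] [cite: MumfordAV1970, §19]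

## References
* [Markman2025SecantWeil] E. Markman, Cycles on abelian 2n-folds of Weil type from secant sheaves on abelian n-folds, Thm 1.5.1.  [Shimura1998] G. Shimura, *Abelian varieties with
  complex multiplication and modular functions*, §6.1, §8.4, §18.2.  [DixonMortimer1996] J. D. Dixon, B. Mortimer, *Permutation Groups*, GTM 163.  [Serre1977] J.-P. Serre,
  *Linear Representations of Finite Groups*, GTM 42, §5.3.  [Lang2002] S. Lang, *Algebra*, GTM 211.  [MumfordAV1970] D. Mumford, *Abelian Varieties*, §19.
-/

noncomputable section

open CategoryTheory CategoryTheory.Limits NumberField IntermediateField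

namespace Summit.HodgeConjecture.CorCM.MultiFieldWeil

open Finset
open Literature.AlgebraicGeometry Literature.AlgebraicGeometry.Motives Literature.AlgebraicGeometry.HodgeTheory
open Literature.AlgebraicGeometry.ComplexMultiplication (IsCMTypeRealisation)
open Literature.AlgebraicTopology.SingularHomology
open Literature.NumberTheory.ComplexMultiplication

open scoped Classical

section Field

variable {K : Type} [fK : Field K] [nK : NumberField K] [cK : IsCMField K] {k : Type} [fk : Field k] [nk : NumberField k] [ck : IsCMField k] {τ : k →+* ℂ}

omit cK in
/-- **FREENESS BY INSPECTION (field level, any family of types).**  Over a decic CM field `K ⊇ iK(k)` (`k` imaginary quadratic) with Galois closure of degree `≤ 20` in `ℂ` and a `τ`-embedding value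
outside the image of another, a family of `τ`-parts `T t = {s over τ : s ∈ Ψ t}` (`t : ι`) two of which are DIFFERENT and SHARE an embedding are stabilised together only by
automorphisms of `ℂ` over `τ(k)` fixing every `τ`-embedding of `K`. [cite: DixonMortimer1996, §1.6, Thm. 1.6A; §3.3] [cite: Lang2002, VI §1 Thm. 1.1] [cite: Shimura1998, §18.2 Lemma (i)] -/
theorem comp_eq_of_stab_of_meet_family (h2 : Module.finrank ℚ k = 2) (iK : k →+* K) (h10 : Module.finrank ℚ K = 10)
    (h20 : Module.finrank ℚ ↥(normalClosure ℚ K ℂ) ≤ 20) (hns : ∃ s₀ t₀ : K →+* ℂ, s₀.comp iK = τ ∧ t₀.comp iK = τ ∧ ∃ x, t₀ x ∉ adjoin ℚ (Set.range s₀))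
    {ι : Type} (Ψ : ι → CMType K) (hcnt : ∀ t, (Finset.univ.filter fun s : K →+* ℂ => s.comp iK = τ ∧ s ∈ (Ψ t).1).card = 2) {i j : ι}
    (hdist : (Finset.univ.filter fun s : K →+* ℂ => s.comp iK = τ ∧ s ∈ (Ψ i).1) ≠ (Finset.univ.filter fun s : K →+* ℂ => s.comp iK = τ ∧ s ∈ (Ψ j).1))
    (hmeet : ∃ s : K →+* ℂ, s.comp iK = τ ∧ s ∈ (Ψ i).1 ∧ s ∈ (Ψ j).1)
    (ρ : ℂ ≃+* ℂ) (hρ : (ρ : ℂ →+* ℂ).comp τ = τ) (hstab : ∀ (t : ι) (s : K →+* ℂ), s.comp iK = τ → (s ∈ (Ψ t).1 ↔ (ρ : ℂ →+* ℂ).comp s ∈ (Ψ t).1))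
    (s : K →+* ℂ) (hs : s.comp iK = τ) : (ρ : ℂ →+* ℂ).comp s = s := by
  have hττ : ComplexEmbedding.conjugate τ ≠ τ := QuarticCM.conjugate_ne τ
  have hk : ∀ σ : k →+* ℂ, σ = τ ∨ σ = ComplexEmbedding.conjugate τ := fun σ => QuarticCM.eq_or_eq_conjugate_of_quadratic h2 τ σ
  have h10' : Module.finrank ℚ K = 2 * 5 := by rw [h10]
  obtain ⟨E₀, hE_sign, -⟩ := exists_signFrame h10' h2 iK hττ hk
  -- a one-slot instance of the engine: fields `Option.elim · k (fun _ => K)`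
  let Kf : Option Unit → Type := fun o => o.elim k fun _ => K
  letI instF : ∀ o, Field (Kf o) := fun o => @Option.rec Unit (fun o => Field (Option.elim o k fun _ => K)) fk (fun _ => fK) o
  letI instN : ∀ o, NumberField (Kf o) := fun o => @Option.rec Unit (fun o => NumberField (Option.elim o k fun _ => K)) nk (fun _ => nK) o
  let is : Fin 1 → Option Unit := fun _ => some ()
  let im : ∀ m : Fin 1, Kf none →+* Kf (is m) := fun _ => iK
  let e : ∀ m : Fin 1, (Kf (is m) →+* ℂ) ≃ Fin ((fun _ : Fin 1 => 5) m) × Bool := fun _ => E₀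
  have he_sign : ∀ (m : Fin 1) (s : Kf (is m) →+* ℂ), (e m s).2 = true ↔ s.comp (im m) = τ := fun _ s => hE_sign s
  -- the realised tuple of `ρ`
  obtain ⟨π, hπ, hπe⟩ := exists_mem_realisedTuples_of_comp_tau_eq (Kf := Kf) (i₀ := none) (is := is) (e := e) (τ := τ) (im := im) he_sign ρ hρ
  -- the two position sets
  let Q : ι → Finset (Fin 5) := fun t => Finset.univ.filter fun a : Fin 5 => E₀.symm (a, true) ∈ (Ψ t).1
  have hmemQ : ∀ t a, a ∈ Q t ↔ E₀.symm (a, true) ∈ (Ψ t).1 := fun t a => by simp only [Q, Finset.mem_filter, Finset.mem_univ, true_and]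
  have hQ : ∀ t, (Q t).card = 2 := fun t => (card_posSet (hE_sign) (Ψ t)).trans (hcnt t)
  have hsa : ∀ s : K →+* ℂ, s.comp iK = τ → E₀.symm ((E₀ s).1, true) = s := fun s hs => by
    rw [show ((E₀ s).1, true) = E₀ s from Prod.ext rfl ((hE_sign s).2 hs).symm, Equiv.symm_apply_apply]
  have hij : Q i ≠ Q j := by
    intro hQQ
    apply hdist
    ext s
    simp only [Finset.mem_filter, Finset.mem_univ, true_and]
    constructor
    · rintro ⟨hs, h0⟩
      refine ⟨hs, ?_⟩
      have := (hmemQ i (E₀ s).1).2 (by rw [hsa s hs]; exact h0)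
      rw [hQQ, hmemQ, hsa s hs] at this
      exact this
    · rintro ⟨hs, h1⟩
      refine ⟨hs, ?_⟩
      have := (hmemQ j (E₀ s).1).2 (by rw [hsa s hs]; exact h1)
      rw [← hQQ, hmemQ, hsa s hs] at this
      exact this
  have hmeetQ : (Q i ∩ Q j).Nonempty := by
    obtain ⟨s', hs', h0, h1⟩ := hmeet
    refine ⟨(E₀ s').1, Finset.mem_inter.2 ⟨?_, ?_⟩⟩
    · rw [hmemQ, hsa s' hs']; exact h0
    · rw [hmemQ, hsa s' hs']; exact h1
  have hstabπ : ∀ (t : ι) (x : Fin 5), π 0 x ∈ Q t ↔ x ∈ Q t := by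
    intro t x
    have hx : (E₀.symm (x, true)).comp iK = τ := (hE_sign _).1 (by simp)
    have hx' : (ρ : ℂ →+* ℂ).comp (E₀.symm (x, true)) = E₀.symm (π 0 x, true) := hπe 0 x
    rw [hmemQ, hmemQ, ← hx']
    exact (hstab t _ hx).symm
  have h1 : π 0 = 1 := eq_one_of_stab_meeting_realisedTuples (Kf := Kf) (i₀ := none) (is := is) (e := e) (τ := τ) (im := im) he_sign 0 rfl h2 h20 hns Q hQ hij hmeetQ π hπ hstabπ
  have this : (ρ : ℂ →+* ℂ).comp (E₀.symm ((E₀ s).1, true)) = E₀.symm (π 0 (E₀ s).1, true) := hπe 0 (E₀ s).1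
  rw [h1, Equiv.Perm.one_apply, hsa s hs] at this
  exact this

end Field

section Grouped

variable {J : Type} [Fintype J] {KJ : J → Type} [fK : ∀ j, Field (KJ j)] [nK : ∀ j, NumberField (KJ j)] [cK : ∀ j, IsCMField (KJ j)]
  {k : Type} [fk : Field k] [nk : NumberField k] [ck : IsCMField k] {τ : k →+* ℂ} {c : J → ℕ}
  {B : ∀ j : J, Fin (c j) → AbelianVariety ℂ} {Ψ : ∀ j : J, Fin (c j) → CMType (KJ j)}
  {ιB : ∀ (j : J) (t : Fin (c j)), 𝓞 (KJ j) →+* End (B j t)} {θB : ∀ (j : J) (t : Fin (c j)), KJ j →+* Module.End ℂ (complexBetti (B j t).X 1)}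
  {E : AbelianVariety ℂ} {Φ₀ : CMType k} {ιE : 𝓞 k →+* End E} {θE : k →+* Module.End ℂ (complexBetti E.X 1)}

/-- **UP TO TWO `(2,3)`-FIVEFOLDS OVER EACH OF SEVERAL DIHEDRAL DECIC CM FIELDS, FREENESS BY INSPECTION — GIVEN ONLY MARKMAN'S HYPERBOLIC-SIXFOLD THEOREM.**  See the module
docstring.  `HC_CM` is NOT asserted. [cite: Markman2025SecantWeil, Thm 1.5.1] [cite: Shimura1998, §6.1 Corollary of Theorem 2, §8.4, §18.2] [cite: DixonMortimer1996, §1.6, Thm. 1.6A;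
§2.1; §3.3] [cite: Serre1977, §5.3] [cite: Lang2002, VI §1 Thm. 1.1; XIII §4] -/
theorem hodgeConjectureFor_biproduct_sigma_of_dihedralDecics_meet (hM6 : Markman2025_weilClasses_algebraic_hyperbolicSixfold)
    (h2 : Module.finrank ℚ k = 2) (iK : ∀ j : J, k →+* KJ j) (hdeg : ∀ j, Module.finrank ℚ (KJ j) = 10)
    (hB : ∀ j t, IsCMTypeRealisation (Ψ j t) (B j t) (ιB j t) (θB j t)) (hE : IsCMTypeRealisation Φ₀ E ιE θE) (hΦ₀ : ∀ σ : k →+* ℂ, σ ∈ Φ₀.1 ↔ σ = τ)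
    (hcnt : ∀ j t, (Finset.univ.filter fun s : KJ j →+* ℂ => s.comp (iK j) = τ ∧ s ∈ (Ψ j t).1).card = 2) (hc : ∀ j, c j ≤ 2)
    (h20 : ∀ j, Module.finrank ℚ ↥(normalClosure ℚ (KJ j) ℂ) ≤ 20)
    (hns : ∀ j, ∃ s₀ t₀ : KJ j →+* ℂ, s₀.comp (iK j) = τ ∧ t₀.comp (iK j) = τ ∧ ∃ x, t₀ x ∉ adjoin ℚ (Set.range s₀))
    (hmeet : ∀ (j : J) (t t' : Fin (c j)), t ≠ t' →
      (Finset.univ.filter fun s : KJ j →+* ℂ => s.comp (iK j) = τ ∧ s ∈ (Ψ j t).1) ≠ (Finset.univ.filter fun s : KJ j →+* ℂ => s.comp (iK j) = τ ∧ s ∈ (Ψ j t').1) ∧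
      ∃ s : KJ j →+* ℂ, s.comp (iK j) = τ ∧ s ∈ (Ψ j t).1 ∧ s ∈ (Ψ j t').1)
    (hiso : ∀ j j' : J, j' ≠ j → IsEmpty (KJ j' →+* KJ j))
    {N : ℕ} (κ : Fin N → Option ((j : J) × Fin (c j))) :
    HodgeConjectureFor (⨁ fun l => ((κ l).elim E fun x => B x.1 x.2 : AbelianVariety ℂ)).dim (⨁ fun l => ((κ l).elim E fun x => B x.1 x.2 : AbelianVariety ℂ)).X :=
  hodgeConjectureFor_biproduct_sigma_of_dihedralDecics' hM6 h2 iK hdeg hB hE hΦ₀ hcnt hc h20 hns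
    (fun j hcj ρ hρ hst s hs => by
      have htt : (⟨0, by omega⟩ : Fin (c j)) ≠ ⟨1, hcj⟩ := fun h => absurd (congrArg Fin.val h) (by norm_num)
      exact comp_eq_of_stab_of_meet_family h2 (iK j) (hdeg j) (h20 j) (hns j) (Ψ j) (hcnt j) (hmeet j _ _ htt).1 (hmeet j _ _ htt).2 ρ hρ hst s hs)
    hiso κ

/-- **Dominated form.** [cite: Markman2025SecantWeil, Thm 1.5.1] [cite: MumfordAV1970, §19] -/
theorem hodgeConjectureFor_of_avDominatedBy_sigma_of_dihedralDecics_meet (hM6 : Markman2025_weilClasses_algebraic_hyperbolicSixfold)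
    (h2 : Module.finrank ℚ k = 2) (iK : ∀ j : J, k →+* KJ j) (hdeg : ∀ j, Module.finrank ℚ (KJ j) = 10)
    (hB : ∀ j t, IsCMTypeRealisation (Ψ j t) (B j t) (ιB j t) (θB j t)) (hE : IsCMTypeRealisation Φ₀ E ιE θE) (hΦ₀ : ∀ σ : k →+* ℂ, σ ∈ Φ₀.1 ↔ σ = τ)
    (hcnt : ∀ j t, (Finset.univ.filter fun s : KJ j →+* ℂ => s.comp (iK j) = τ ∧ s ∈ (Ψ j t).1).card = 2) (hc : ∀ j, c j ≤ 2)
    (h20 : ∀ j, Module.finrank ℚ ↥(normalClosure ℚ (KJ j) ℂ) ≤ 20)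
    (hns : ∀ j, ∃ s₀ t₀ : KJ j →+* ℂ, s₀.comp (iK j) = τ ∧ t₀.comp (iK j) = τ ∧ ∃ x, t₀ x ∉ adjoin ℚ (Set.range s₀))
    (hmeet : ∀ (j : J) (t t' : Fin (c j)), t ≠ t' →
      (Finset.univ.filter fun s : KJ j →+* ℂ => s.comp (iK j) = τ ∧ s ∈ (Ψ j t).1) ≠ (Finset.univ.filter fun s : KJ j →+* ℂ => s.comp (iK j) = τ ∧ s ∈ (Ψ j t').1) ∧
      ∃ s : KJ j →+* ℂ, s.comp (iK j) = τ ∧ s ∈ (Ψ j t).1 ∧ s ∈ (Ψ j t').1)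
    (hiso : ∀ j j' : J, j' ≠ j → IsEmpty (KJ j' →+* KJ j))
    {N : ℕ} (κ : Fin N → Option ((j : J) × Fin (c j))) {X : AbelianVariety ℂ}
    (hX : Domination.AVDominatedBy X (⨁ fun l => ((κ l).elim E fun x => B x.1 x.2 : AbelianVariety ℂ))) : HodgeConjectureFor X.dim X.X :=
  Domination.hodgeConjectureFor_of_avDominatedBy
    (hodgeConjectureFor_biproduct_sigma_of_dihedralDecics_meet hM6 h2 iK hdeg hB hE hΦ₀ hcnt hc h20 hns hmeet hiso κ) hX

end Grouped

end Summit.HodgeConjecture.CorCM.MultiFieldWeil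

end
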